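import Summits.BirchSwinnertonDyer.Rank1Residual.Supersingular.KuriharaNumberModTwoVanishing
import Literature.NumberTheory.EllipticCurves.KatoKolyvaginPrimes
import HarnessLib

/-!
# `OrdLambdaHalfAtTwo` (crux `stmt-BirchSwinnertonDyer-19556`), line `two-power-slack-rigidity-two`:
# a UNIT scaled Kurihara number at `p = 2` only exists at level `k = 1` (or at the empty product `n = 1`)

Negative (load-bearing) lemma for the SUPPLY statement `UnitKuriharaSupplyAtTwo` /
`UnitKuriharaWitnessAtTwo` of the crux sketch
`Cruxes/OrdLambdaHalfAtTwo/TwoPowerSlackRigidityTwoSketch.lean` (cdisprove seat, `--supports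
stmt-BirchSwinnertonDyer-19556`).  The sketch's scaled Kurihara number is
`δ^{(c)}_n = ∑_{a ∈ (ℤ/n)ˣ} ratModP (2^k) (c·[a/n]⁺_f) · ∏_{ℓ ∣ n} ψ_ℓ(a) ∈ ℤ/2^k`.

* `castHom_two_sum_mul_prod_toAdd_eq_zero` — for ANY even coefficient function `F : (ℤ/n)ˣ → ℤ/2^k`
  (`F(−a) = F(a)`), any `k ≥ 1`, any `n > 2` all of whose prime factors are `≡ 1 (mod 4)` and ANY discrete
  logarithms `ψ_ℓ : (ℤ/ℓ)ˣ → ℤ/2^k`, the image of `∑_a F(a) ∏_ℓ ψ_ℓ(a)` in `ℤ/2` is `0`: reduce the `ψ_ℓ`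
  mod `2`, where they kill `−1` (`(ℓ−1)/2` even), and pair `a ↔ −a` (the tree's involution argument
  `Rank1Residual.Supersingular.kuriharaNumber_two_eq_zero`, which is the case `k = 1`, `c = 1`).
* `not_isUnit_sum_ratModP_mul_prod_toAdd` — hence `δ^{(c)}_n` (the sketch's `kuriharaNumberScaled f c k n ψ`,
  unfolded verbatim) is NEVER a unit of `ℤ/2^k` at such `(k, n)`, for every scaling `c` (no integrality
  hypothesis is needed: evenness of `a ↦ c·[a/n]⁺` is all that is used).
* `two_lt_and_mod_four_of_isKolyvaginProduct` — a Kato–Kim Kolyvagin product `n ∈ 𝒩_k(W, 2)` of level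
  `k ≥ 2` other than `n = 1` has `n > 2` and all prime factors `≡ 1 (mod 4)` (`ℓ ≡ 1 (mod 2^k)`, `4 ∣ 2^k`;
  `n = 2` is excluded by `ℓ ∤ N·2`).
* `level_eq_one_or_eq_one_of_isUnit` — CONSEQUENCE: if `δ^{(c)}_n` is a unit for a Kolyvagin product `n` of
  level `k ≥ 1`, then `k = 1 ∨ n = 1`.  So every `UnitKuriharaWitnessAtTwo W f` witness is a LEVEL-ONE
  witness (`ℤ/2`-valued, and then some `ℓ ∣ n` is `≡ 3 (mod 4)` unless `n ≤ 2`) or the empty product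
  `n = 1` (`δ^{(c)}_1 = ratModP (2^k) (c·[0]⁺) = c·L(E,1)/Ω⁺` up to the normalisation: a unit only in
  analytic rank `0`).  For curves of positive rank the supply statement therefore lives entirely on
  square-free products of level-1 primes containing a prime `≡ 3 (mod 4)` — the search space of the
  batched falsifier job of this seat (kit j313310 ff.).

No statement of the route is asserted; nothing here bears on `OrdLambdaHalfAtTwo` itself (BSD is not
proved by any of this).  References: C.-H. Kim, arXiv:2203.12159, §1.2.2 (Kolyvagin primes `𝒫_k`,
products `𝒩_k`); M. Kurihara, Doc. Math. Extra Vol. Kato (2003) 539–563 (the numbers `δ_n`). [folklore]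
-/

set_option autoImplicit false

noncomputable section

open scoped Classical MatrixGroups ModularForm

open CongruenceSubgroup Literature.NumberTheory.EllipticCurves Literature.NumberTheory.EllipticCurves.ModularForms
open Literature.NumberTheory.DiophantineGeometry.Dioph (ratModP)
open Summit.BirchSwinnertonDyer.Rank1Residual.Supersingular

namespace Summit.BirchSwinnertonDyer.BirchSwinnertonDyer.Theorems.OrdLambdaHalfAtTwo.Negative

/-- **Involution lemma, arbitrary level.** For `k ≥ 1`, `n > 2` with all prime factors `≡ 1 (mod 4)`, an even
coefficient function `F` and any discrete logarithms `ψ_ℓ` with values in `ℤ/2^k`, the sum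
`∑_{a ∈ (ℤ/n)ˣ} F(a) ∏_{ℓ ∣ n} ψ_ℓ(a)` maps to `0` in `ℤ/2`. [folklore] -/
theorem castHom_two_sum_mul_prod_toAdd_eq_zero {k n : ℕ} [NeZero n] (hk : 1 ≤ k) (hn : 2 < n)
    (h4 : ∀ ℓ ∈ n.primeFactors, ℓ % 4 = 1) (F : (ZMod n)ˣ → ZMod (2 ^ k)) (hF : ∀ a, F (-a) = F a)
    (ψ : (ℓ : ℕ) → (ZMod ℓ)ˣ →* Multiplicative (ZMod (2 ^ k))) :
    ZMod.castHom (dvd_pow_self 2 (by omega) : 2 ∣ 2 ^ k) (ZMod 2)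
      (∑ a : (ZMod n)ˣ, F a * ∏ ℓ ∈ n.primeFactors.attach,
        Multiplicative.toAdd (ψ ℓ.1 (ZMod.unitsMap (Nat.dvd_of_mem_primeFactors ℓ.2) a))) = 0 := by
  set π : ZMod (2 ^ k) →+* ZMod 2 := ZMod.castHom (dvd_pow_self 2 (by omega) : 2 ∣ 2 ^ k) (ZMod 2)
  -- the discrete logarithms reduced mod 2
  let ψ' : (ℓ : ℕ) → (ZMod ℓ)ˣ →* Multiplicative (ZMod 2) :=
    fun ℓ => (AddMonoidHom.toMultiplicative π.toAddMonoidHom).comp (ψ ℓ)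
  have hψ' : ∀ ℓ ∈ n.primeFactors, ψ' ℓ (-1) = 1 := fun ℓ hℓ => by
    haveI : Fact ℓ.Prime := ⟨Nat.prime_of_mem_primeFactors hℓ⟩
    exact map_neg_one_eq_one_of_mod_four_eq_one (h4 ℓ hℓ) (ψ' ℓ)
  have key : ∀ (ℓ : ℕ) (u : (ZMod ℓ)ˣ),
      π (Multiplicative.toAdd (ψ ℓ u)) = Multiplicative.toAdd (ψ' ℓ u) := fun ℓ u => rfl
  rw [map_sum]
  simp_rw [map_mul, map_prod, key]
  refine Finset.sum_involution (fun a _ => -a) ?_ ?_ (fun a _ => Finset.mem_univ _) (fun a _ => neg_neg a)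
  · intro a _
    rw [hF a, prod_toAdd_unitsMap_neg_eq 2 ψ' hψ' a]
    have h2 : ∀ z : ZMod 2, z + z = 0 := by decide
    exact h2 _
  · intro a _ _
    exact neg_ne_self_of_two_lt hn a

/-- **The scaled Kurihara number at `2` is never a unit at a level whose primes are all `≡ 1 (mod 4)`.**
For every cusp form `f` on `Γ₀(N)`, every scaling `c ∈ ℚ`, every `k ≥ 1`, every `n > 2` with all prime factors
`≡ 1 (mod 4)` and every choice of discrete logarithms,
`∑_{a ∈ (ℤ/n)ˣ} ratModP (2^k) (c·[a/n]⁺_f) ∏_{ℓ ∣ n} ψ_ℓ(a)` — the sketch's `kuriharaNumberScaled f c k n ψ`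
unfolded — is not a unit of `ℤ/2^k` (its image in `ℤ/2` vanishes by the involution lemma and evenness
`[−r]⁺ = [r]⁺`, `[r+1]⁺ = [r]⁺`). [folklore] -/
theorem not_isUnit_sum_ratModP_mul_prod_toAdd {N : ℕ} [NeZero N] (f : CuspForm (Gamma0 N) 2) (c : ℚ)
    {k n : ℕ} [NeZero n] (hk : 1 ≤ k) (hn : 2 < n) (h4 : ∀ ℓ ∈ n.primeFactors, ℓ % 4 = 1)
    (ψ : (ℓ : ℕ) → (ZMod ℓ)ˣ →* Multiplicative (ZMod (2 ^ k))) :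
    ¬ IsUnit (∑ a : (ZMod n)ˣ, ratModP (2 ^ k) (c * ratPlusSymbol f (((a : ZMod n).val : ℚ) / n)) *
      ∏ ℓ ∈ n.primeFactors.attach,
        Multiplicative.toAdd (ψ ℓ.1 (ZMod.unitsMap (Nat.dvd_of_mem_primeFactors ℓ.2) a))) := by
  intro hu
  have h0 := castHom_two_sum_mul_prod_toAdd_eq_zero hk hn h4
    (fun a : (ZMod n)ˣ => ratModP (2 ^ k) (c * ratPlusSymbol f (((a : ZMod n).val : ℚ) / n)))
    (fun a => by simp only [Units.val_neg, ratPlusSymbol_neg_val_div_eq f (a : ZMod n)]) ψ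
  exact (hu.map (ZMod.castHom (dvd_pow_self 2 (by omega) : 2 ∣ 2 ^ k) (ZMod 2))).ne_zero h0

/-- **Kolyvagin products of level `k ≥ 2` at `p = 2`.** If `n ≠ 1` is a square-free product of Kato–Kim Kolyvagin
primes of level `k ≥ 2` for `(W, 2)` (Kim, arXiv:2203.12159, §1.2.2: `ℓ ∤ 2N`, `ℓ ≡ 1 (mod 2^k)`,
`a_ℓ ≡ ℓ + 1 (mod 2^k)`), then `n > 2` and every prime factor of `n` is `≡ 1 (mod 4)`. [folklore] -/
theorem two_lt_and_mod_four_of_isKolyvaginProduct (W : WeierstrassCurve ℚ) [W.IsGloballyMinimal]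
    {k n : ℕ} (hk : 2 ≤ k) (h : Kato.IsKolyvaginProduct W 2 k n) (hn1 : n ≠ 1) :
    2 < n ∧ ∀ ℓ ∈ n.primeFactors, ℓ % 4 = 1 := by
  have h4 : ∀ ℓ ∈ n.primeFactors, ℓ % 4 = 1 := fun ℓ hℓ => by
    have hmod : ℓ ≡ 1 [MOD 2 ^ k] := (h.2 ℓ hℓ).2.2.1
    have hdvd : 4 ∣ 2 ^ k := by
      rw [show (4 : ℕ) = 2 ^ 2 by norm_num]
      exact Nat.pow_dvd_pow 2 hk
    have := Nat.ModEq.of_dvd hdvd hmod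
    simpa [Nat.ModEq] using this
  refine ⟨?_, h4⟩
  have hn0 : n ≠ 0 := fun h0 => by
    subst h0
    exact absurd h.1 not_squarefree_zero
  have hn2 : n ≠ 2 := fun h2 => by
    subst h2
    have h2mem : 2 ∈ (2 : ℕ).primeFactors := Nat.mem_primeFactors.mpr ⟨Nat.prime_two, dvd_rfl, two_ne_zero⟩
    exact (h.2 2 h2mem).2.1 (dvd_mul_left 2 _)
  omega

/-- **Every unit scaled Kurihara witness at `2` is of level one (or the empty product).** If `n` is a Kolyvagin
product of level `k ≥ 1` for `(W, 2)` and `∑_{a ∈ (ℤ/n)ˣ} ratModP (2^k) (c·[a/n]⁺_f) ∏_{ℓ ∣ n} ψ_ℓ(a)` is a unit of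
`ℤ/2^k`, then `k = 1` or `n = 1`.  (So the `∃ (c, k, n, ψ)` of `UnitKuriharaWitnessAtTwo W f` can only be
instantiated with `k = 1` — a `ℤ/2`-valued parity — or with `n = 1`, the `L`-value term.) [folklore] -/
theorem level_eq_one_or_eq_one_of_isUnit (W : WeierstrassCurve ℚ) [W.IsGloballyMinimal]
    {N : ℕ} [NeZero N] (f : CuspForm (Gamma0 N) 2) (c : ℚ) {k n : ℕ} [NeZero n]
    (ψ : (ℓ : ℕ) → (ZMod ℓ)ˣ →* Multiplicative (ZMod (2 ^ k))) (hk : 1 ≤ k)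
    (hprod : Kato.IsKolyvaginProduct W 2 k n)
    (hu : IsUnit (∑ a : (ZMod n)ˣ, ratModP (2 ^ k) (c * ratPlusSymbol f (((a : ZMod n).val : ℚ) / n)) *
      ∏ ℓ ∈ n.primeFactors.attach,
        Multiplicative.toAdd (ψ ℓ.1 (ZMod.unitsMap (Nat.dvd_of_mem_primeFactors ℓ.2) a)))) :
    k = 1 ∨ n = 1 := by
  by_contra hne
  push Not at hne
  obtain ⟨hn2, h4⟩ := two_lt_and_mod_four_of_isKolyvaginProduct W (by omega) hprod hne.2
  exact not_isUnit_sum_ratModP_mul_prod_toAdd f c hk hn2 h4 ψ hu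

/-- The same conclusion phrased on the prime factors: a unit at level `k ≥ 1` with `n > 2` forces a prime factor
`ℓ ∣ n` with `ℓ % 4 ≠ 1` (for the odd Kolyvagin primes: `ℓ ≡ 3 (mod 4)`, hence `k = 1`). [folklore] -/
theorem exists_primeFactor_mod_four_ne_one_of_isUnit {N : ℕ} [NeZero N] (f : CuspForm (Gamma0 N) 2) (c : ℚ)
    {k n : ℕ} [NeZero n] (ψ : (ℓ : ℕ) → (ZMod ℓ)ˣ →* Multiplicative (ZMod (2 ^ k))) (hk : 1 ≤ k)
    (hn : 2 < n)
    (hu : IsUnit (∑ a : (ZMod n)ˣ, ratModP (2 ^ k) (c * ratPlusSymbol f (((a : ZMod n).val : ℚ) / n)) *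
      ∏ ℓ ∈ n.primeFactors.attach,
        Multiplicative.toAdd (ψ ℓ.1 (ZMod.unitsMap (Nat.dvd_of_mem_primeFactors ℓ.2) a)))) :
    ∃ ℓ ∈ n.primeFactors, ℓ % 4 ≠ 1 := by
  by_contra hall
  push Not at hall
  exact not_isUnit_sum_ratModP_mul_prod_toAdd f c hk hn hall ψ hu

end Summit.BirchSwinnertonDyer.BirchSwinnertonDyer.Theorems.OrdLambdaHalfAtTwo.Negative

end
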